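import Summits.HodgeConjecture.CorCM.MultiFieldWeilStabiliserTransfer
import Summits.HodgeConjecture.CorCM.MultiFieldWeilMarkmanTowers
import Summits.HodgeConjecture.CorCM.MultiFieldWeilGaloisHypotheses
import HarnessLib

/-!
# MULTI-FIELD WEIL ENGINE — NO TOWER: ANY NUMBER of CM fields of PRIME relative degree over `k` whose realised tuples are STABILISER-TRANSITIVE
# (sextic fields through `k`: each one outside the Galois closure of each other — e.g. the pure cubic triple `k(∛a), k(∛b), k(∛ab)`) — the Hodge conjecture for
# every product of copies of `E, B_1, …, B_r`, GIVEN ONLY the single-slot Weil spaces ∕ Markman's theorems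

Cell `pub-hodgecm2` (COR-CM), seat b30 gen 35 (2026-08-25); count-neutral own lane MULTI-FIELD WEIL ENGINE (stem `MultiFieldWeil*`), the geometric consumer of
`CorCM/MultiFieldWeilStabiliserTransfer.lean` (the defect law without a tower).  Theorems only; no definition, no named fact, no `sorry`.  HONEST FRAMING: the frame ∕
intrinsic headlines (§2) are conditional on the displayed single-slot Weil spaces `hW m`; the Markman consumers (§3–§4) are conditional ONLY on
`Markman2025_weilClasses_algebraic_abelianFourfold` (sextic slots) ∕ `Markman2025_weilClasses_algebraic_hyperbolicSixfold` (decic slots); `HC_CM` is NOT proved and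
not asserted.

THE STATEMENT.  `k = Kf i₀` imaginary quadratic with `τ : k → ℂ`, `E = A 0 ⊨ (k; {τ})`, `B_m = A (m+1) ⊨ (K_m; Φ (m+1))` over CM fields `K_m ⊇ i_m(k)` of PRIME relative
degrees `n_m` (any types with `0 < p_m`, `2 p_m < n_m`... read by frames).  HYPOTHESIS (**stabiliser-transitivity**, `hST`): for all slots `m₀ ≠ m` and all
`τ`-embeddings `s, s′` of `K_m` there is an automorphism of `ℂ` over `τ(k)` FIXING every `τ`-embedding of `K_{m₀}` and carrying `s` to `s′`.  THEN the Hodge conjecture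
holds for EVERY product of copies `⨁_j A(κ j)` given the single-slot Weil spaces (§2 **`hodgeConjectureFor_biproduct_comp_of_stabiliserTransitive`**, intrinsic form
`…_intrinsic`); for sextic `(1,2)` ∕ decic `(2,3)` slots GIVEN ONLY Markman's theorems (§3 **`hodgeConjectureFor_biproduct_comp_of_sexticsDecics_of_stabiliserTransitive`**).
§4 (**`hodgeConjectureFor_biproduct_comp_of_sextics_of_outside_closures`**): for SEXTIC fields the hypothesis is implied by «no `τ`-embedding of `K_m` takes all its
values in the Galois closure of `K_{m₀}` in `ℂ`» (`m₀ ≠ m`) — a PAIRWISE condition (for sextic CM fields through `k` it says `K_m ≇ K_{m₀}`), because a group acting on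
three points without fixed points is transitive (§1, `stabTransitive_of_movers_three`).  This REMOVES the tower ∕ ordering hypothesis of gens 29–34
(`…_of_sexticTower`, `htower`, `hH`): e.g. `k(∛2), k(∛3), k(∛6)` over `k = ℚ(√−3)` (third field inside the compositum of the first two) is covered — the remark in
`CorCM/MultiFieldWeilMarkmanTowers.lean` that this triple «carries Hodge classes outside the span the engine produces» concerned the engine's old route, not the classes:
the balanced weights of such a family coincide with those of a tower (the span of the translates of the type vector is the same).

[cite: Markman2025SurveySecant, Thm. 1.2] [cite: Markman2025SecantWeil, Thm 1.5.1] [cite: Pohlmann1968, Thm 1] [cite: MoonenZarhin1995Duke, Thm. 2.4]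
[cite: Lang2002, VI §1 Thm. 1.1, Cor. 1.6 and V §2 Thm. 2.8] [cite: Shimura1998, §18.2 Lemma (i)] [cite: DixonMortimer1996, §1.6 and Thm. 1.6A] [cite: MumfordAV1970, §19]

## References
* [Markman2025SurveySecant] E. Markman, arXiv:2509.23403, Thm. 1.2.  [Markman2025SecantWeil] E. Markman, Cycles on abelian 2n-folds of Weil type from secant sheaves on abelian
  n-folds, Thm 1.5.1.  [Pohlmann1968] H. Pohlmann, Ann. of Math. 88 (1968), Thm 1.  [MoonenZarhin1995Duke] B. Moonen, Yu. Zarhin, Duke Math. J. 77 (1995), Thm. 2.4.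
  [Lang2002] S. Lang, *Algebra*, GTM 211, V §2, VI §1.  [Shimura1998] G. Shimura, *Abelian varieties with CM and modular functions*, §18.2.  [DixonMortimer1996] J. D. Dixon,
  B. Mortimer, *Permutation Groups*, GTM 163, §1.6.  [MumfordAV1970] D. Mumford, *Abelian Varieties*, §19.
-/

noncomputable section

open CategoryTheory CategoryTheory.Limits NumberField IntermediateField

namespace Summit.HodgeConjecture.CorCM.MultiFieldWeil

open Finset
open Literature.AlgebraicGeometry Literature.AlgebraicGeometry.Motives Literature.AlgebraicGeometry.HodgeTheory
open Literature.AlgebraicGeometry.ComplexMultiplication (IsCMTypeRealisation)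
open Literature.AlgebraicTopology.SingularHomology
open Literature.NumberTheory.ComplexMultiplication
open Summit.HodgeConjecture.CorCM.Census.MultiFieldWeil

open scoped Classical

/-! ## §1 Model: three points — movers give transitivity; realised: stabiliser-transitivity from automorphisms -/

section Model

variable {r : ℕ} {n : Fin r → ℕ} {R : Finset (PermsG n)}

/-- The third point of a three-element slot: for `a ≠ a'` in `Fin (n m)`, `n m = 3`, there is `b` with every point equal to `a`, `a'` or `b`. [folklore] -/
private theorem exists_third₃₅ {k : ℕ} (h3 : k = 3) {a a' : Fin k} (h : a ≠ a') : ∃ b : Fin k, ∀ x : Fin k, x = a ∨ x = a' ∨ x = b := by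
  have hcard : ((Finset.univ.erase a).erase a').card = 1 := by
    rw [Finset.card_erase_of_mem (Finset.mem_erase.2 ⟨Ne.symm h, Finset.mem_univ _⟩), Finset.card_erase_of_mem (Finset.mem_univ _), Finset.card_univ,
      Fintype.card_fin, h3]
  obtain ⟨b, hb⟩ := Finset.card_eq_one.1 hcard
  refine ⟨b, fun x => ?_⟩
  by_cases hxa : x = a
  · exact Or.inl hxa
  by_cases hxa' : x = a'
  · exact Or.inr (Or.inl hxa')
  have hx : x ∈ (Finset.univ.erase a).erase a' := Finset.mem_erase.2 ⟨hxa', Finset.mem_erase.2 ⟨hxa, Finset.mem_univ _⟩⟩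
  rw [hb, Finset.mem_singleton] at hx
  exact Or.inr (Or.inr hx)

/-- **On three points, a group of permutations without a fixed point is transitive** (stabiliser form): `R ⊆ ∏_m Sym(n_m)` closed under products and inverses and
non-empty, `n_m = 3`; if every position of the slot `m` is MOVED by a tuple of `R` trivial at `m₀`, then the tuples of `R` trivial at `m₀` are transitive on the slot `m`
(the orbit of `a` contains `a` and the third point; the inverse of a mover of `a'` brings `a'` into it). [cite: DixonMortimer1996, §1.6] -/
theorem stabTransitive_of_movers_three (hmul : ∀ π ∈ R, ∀ π' ∈ R, π * π' ∈ R) (hinv : ∀ π ∈ R, π⁻¹ ∈ R) (hne : R.Nonempty) {m₀ m : Fin r}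
    (h3 : n m = 3) (hmov : ∀ a : Fin (n m), ∃ ν ∈ R, ν m₀ = 1 ∧ ν m a ≠ a) (a a' : Fin (n m)) : ∃ ν ∈ R, ν m₀ = 1 ∧ ν m a = a' := by
  have h1 : (1 : PermsG n) ∈ R := one_mem_of_closed hmul hinv hne
  by_cases haa : a = a'
  · exact ⟨1, h1, rfl, by rw [haa]; rfl⟩
  -- the orbit of `a` under the tuples trivial at `m₀`
  have hstep : ∀ x : Fin (n m), (∃ ν ∈ R, ν m₀ = 1 ∧ ν m a = x) → ∀ ν' ∈ R, ν' m₀ = 1 → ∃ ν ∈ R, ν m₀ = 1 ∧ ν m a = ν' m x := by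
    rintro x ⟨ν, hν, hν₀, hνa⟩ ν' hν' hν'₀
    exact ⟨ν' * ν, hmul _ hν' _ hν, by rw [Pi.mul_apply, hν'₀, hν₀, mul_one], by rw [Pi.mul_apply, Equiv.Perm.mul_apply, hνa]⟩
  by_contra hna'
  obtain ⟨b, hall⟩ := exists_third₃₅ h3 haa
  -- `a` is moved, to the third point `b`
  obtain ⟨ν₁, hν₁, hν₁₀, hν₁a⟩ := hmov a
  have hreach₁ : ∃ ν ∈ R, ν m₀ = 1 ∧ ν m a = ν₁ m a := ⟨ν₁, hν₁, hν₁₀, rfl⟩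
  have hb : ∃ ν ∈ R, ν m₀ = 1 ∧ ν m a = b := by
    rcases hall (ν₁ m a) with h | h | h
    · exact absurd h hν₁a
    · exact absurd (h ▸ hreach₁) hna'
    · exact h ▸ hreach₁
  -- `a'` is moved, into the orbit; pull back by the inverse
  obtain ⟨ν₂, hν₂, hν₂₀, hν₂a⟩ := hmov a'
  have hc : ∃ ν ∈ R, ν m₀ = 1 ∧ ν m a = ν₂ m a' := by
    rcases hall (ν₂ m a') with h | h | h
    · rw [h]; exact ⟨1, h1, rfl, rfl⟩
    · exact absurd h hν₂a
    · rw [h]; exact hb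
  apply hna'
  obtain ⟨ν, hν, hν₀, hνa⟩ := hstep _ hc ν₂⁻¹ (hinv _ hν₂) (by rw [Pi.inv_apply, hν₂₀, inv_one])
  refine ⟨ν, hν, hν₀, ?_⟩
  rw [hνa, Pi.inv_apply, Equiv.Perm.inv_def, Equiv.symm_apply_apply]

end Model

/-! ## §1b Realised tuples: stabiliser-transitivity from automorphisms of `ℂ`; movers from values outside a Galois closure -/

section Realised

variable {I : Type} {r : ℕ} {Kf : I → Type} [∀ i, Field (Kf i)] [∀ i, NumberField (Kf i)] {i₀ : I} {is : Fin r → I} {n : Fin r → ℕ}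
  {e : ∀ m : Fin r, (Kf (is m) →+* ℂ) ≃ Fin (n m) × Bool} {τ : Kf i₀ →+* ℂ} {im : ∀ m : Fin r, Kf i₀ →+* Kf (is m)}
  (he_sign : ∀ (m : Fin r) (s : Kf (is m) →+* ℂ), (e m s).2 = true ↔ s.comp (im m) = τ)

omit [∀ i, NumberField (Kf i)] in
include he_sign in
/-- **An automorphism of `ℂ` over `τ(k)` fixing every `τ`-embedding of `K_{m₀}` and carrying the `τ`-embedding at position `a` of `K_m` to the one at position `a'` realises
a tuple trivial at `m₀` with `a ↦ a'` at `m`.** [cite: Shimura1998, §18.2 Lemma (i)] -/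
theorem exists_realisedTuple_trivial_apply_eq (m₀ m : Fin r) (a a' : Fin (n m)) (ρ : ℂ ≃+* ℂ) (hρ : (ρ : ℂ →+* ℂ).comp τ = τ)
    (hfix : ∀ u : Kf (is m₀) →+* ℂ, u.comp (im m₀) = τ → (ρ : ℂ →+* ℂ).comp u = u)
    (hmove : (ρ : ℂ →+* ℂ).comp ((e m).symm (a, true)) = (e m).symm (a', true)) :
    ∃ ν ∈ realisedTuples e τ, ν m₀ = 1 ∧ ν m a = a' := by
  obtain ⟨π, hπ, hπρ⟩ := exists_mem_realisedTuples_of_comp_tau_eq (e := e) he_sign ρ hρ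
  refine ⟨π, hπ, ?_, ?_⟩
  · ext b
    have hs : ((e m₀).symm (b, true)).comp (im m₀) = τ := (he_sign m₀ _).1 (by rw [Equiv.apply_symm_apply])
    have h := hπρ m₀ b
    rw [hfix _ hs] at h
    exact congrArg Fin.val ((Prod.mk.inj ((e m₀).symm.injective h)).1).symm
  · have h := hπρ m a
    rw [hmove] at h
    exact ((Prod.mk.inj ((e m).symm.injective h)).1).symm

omit [∀ i, NumberField (Kf i)] in
include he_sign in
/-- **Stabiliser-transitivity of the realised tuples from automorphisms**: if for `m₀ ≠ m` and all `τ`-embeddings `s, s'` of `K_m` some automorphism of `ℂ` over `τ(k)` fixes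
every `τ`-embedding of `K_{m₀}` and carries `s` to `s'`, then the realised tuples trivial at `m₀` are transitive on the slot `m`. [cite: Shimura1998, §18.2 Lemma (i)] -/
theorem stabTransitive_realisedTuples_of_aut
    (hST : ∀ (m₀ m : Fin r), m₀ ≠ m → ∀ s s' : Kf (is m) →+* ℂ, s.comp (im m) = τ → s'.comp (im m) = τ →
      ∃ ρ : ℂ ≃+* ℂ, (ρ : ℂ →+* ℂ).comp τ = τ ∧ (∀ u : Kf (is m₀) →+* ℂ, u.comp (im m₀) = τ → (ρ : ℂ →+* ℂ).comp u = u) ∧ (ρ : ℂ →+* ℂ).comp s = s')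
    (m₀ m : Fin r) (hm : m₀ ≠ m) (a a' : Fin (n m)) : ∃ ν ∈ realisedTuples e τ, ν m₀ = 1 ∧ ν m a = a' := by
  have hs : ((e m).symm (a, true)).comp (im m) = τ := (he_sign m _).1 (by rw [Equiv.apply_symm_apply])
  have hs' : ((e m).symm (a', true)).comp (im m) = τ := (he_sign m _).1 (by rw [Equiv.apply_symm_apply])
  obtain ⟨ρ, hρ, hfix, hmove⟩ := hST m₀ m hm _ _ hs hs'
  exact exists_realisedTuple_trivial_apply_eq he_sign m₀ m a a' ρ hρ hfix hmove

include he_sign in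
/-- **Movers from values outside a Galois closure**: if the `τ`-embedding of `K_m` at position `a` takes a value OUTSIDE the Galois closure `L(K_{m₀})` of `K_{m₀}` in `ℂ`,
then some realised tuple is trivial at `m₀` and moves `a` (the fixed field of `Aut(ℂ/L(K_{m₀}))` is `L(K_{m₀})`, which contains `τ(k)` and the images of all embeddings of
`K_{m₀}`). [cite: Lang2002, VI §1 Thm. 1.1 and Cor. 1.6] [cite: Shimura1998, §18.2 Lemma (i)] -/
theorem exists_realisedTuple_trivial_apply_ne (hn₀ : ∀ m, 0 < n m) (m₀ m : Fin r) (a : Fin (n m))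
    (hout : ∃ x, (e m).symm (a, true) x ∉ normalClosure ℚ (Kf (is m₀)) ℂ) : ∃ ν ∈ realisedTuples e τ, ν m₀ = 1 ∧ ν m a ≠ a := by
  set M : IntermediateField ℚ ℂ := normalClosure ℚ (Kf (is m₀)) ℂ with hM
  obtain ⟨x, hx⟩ := hout
  obtain ⟨ρ, hρM, hρs⟩ := exists_ringEquiv_fix_comp_ne_of_apply_not_mem M ((e m).symm (a, true)) hx
  -- `ρ` fixes `τ(k)` and every embedding of `K_{m₀}`
  have ht : ((e m₀).symm (⟨0, hn₀ m₀⟩, true)).comp (im m₀) = τ := (he_sign m₀ _).1 (by rw [Equiv.apply_symm_apply])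
  have hρτ : (ρ : ℂ →+* ℂ).comp τ = τ := by
    ext y
    have hy : τ y ∈ M := by
      rw [← ht]
      exact ringHom_apply_mem_normalClosure _ _
    exact hρM _ hy
  have hfix : ∀ u : Kf (is m₀) →+* ℂ, u.comp (im m₀) = τ → (ρ : ℂ →+* ℂ).comp u = u := fun u _ =>
    RingHom.ext fun y => hρM _ (ringHom_apply_mem_normalClosure u y)
  obtain ⟨π, hπ, hπρ⟩ := exists_mem_realisedTuples_of_comp_tau_eq (e := e) he_sign ρ hρτ
  refine ⟨π, hπ, ?_, fun h => hρs ?_⟩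
  · ext b
    have hs : ((e m₀).symm (b, true)).comp (im m₀) = τ := (he_sign m₀ _).1 (by rw [Equiv.apply_symm_apply])
    have h := hπρ m₀ b
    rw [hfix _ hs] at h
    exact congrArg Fin.val ((Prod.mk.inj ((e m₀).symm.injective h)).1).symm
  · have h' := hπρ m a
    rw [h] at h'
    exact h'

include he_sign in
/-- **Stabiliser-transitivity for SEXTIC slots from values outside the Galois closures**: `n_m = 3`; if every `τ`-embedding of `K_m` takes a value outside `L(K_{m₀})`
(`m₀ ≠ m`), the realised tuples trivial at `m₀` are transitive on the slot `m` (three points, no fixed point). [cite: DixonMortimer1996, §1.6] [cite: Lang2002, VI §1 Cor. 1.6] -/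
theorem stabTransitive_realisedTuples_of_outside (hn₀ : ∀ m, 0 < n m) (m₀ m : Fin r) (h3 : n m = 3)
    (hout : ∀ s : Kf (is m) →+* ℂ, s.comp (im m) = τ → ∃ x, s x ∉ normalClosure ℚ (Kf (is m₀)) ℂ) (a a' : Fin (n m)) :
    ∃ ν ∈ realisedTuples e τ, ν m₀ = 1 ∧ ν m a = a' :=
  stabTransitive_of_movers_three (fun _ hπ _ hπ' => mul_mem_realisedTuples e τ hπ hπ') (fun _ hπ => inv_mem_realisedTuples hπ)
    (realisedTuples_nonempty (e := e) he_sign) h3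
    (fun b => exists_realisedTuple_trivial_apply_ne he_sign hn₀ m₀ m b (hout _ ((he_sign m _).1 (by rw [Equiv.apply_symm_apply])))) a a'

end Realised

/-! ## §2 The headline: frame form and intrinsic form -/

section Headline

variable {I : Type} {r : ℕ} {Kf : I → Type} [∀ i, Field (Kf i)] [∀ i, NumberField (Kf i)] [∀ i, IsCMField (Kf i)]
  {i₀ : I} {is : Fin r → I} {n : Fin r → ℕ} {τ : Kf i₀ →+* ℂ}
  {A : Fin (r + 1) → AbelianVariety ℂ} {Φ : ∀ j : Fin (r + 1), CMType (Kf (mfSlots i₀ is j))}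
  {ι : ∀ j, 𝓞 (Kf (mfSlots i₀ is j)) →+* End (A j)}
  {θ : ∀ j, Kf (mfSlots i₀ is j) →+* Module.End ℂ (complexBetti (A j).X 1)}

/-- **HEADLINE (frame form) — PRIME RELATIVE DEGREES, ANY TYPES, STABILISER-TRANSITIVE REALISED TUPLES; NO TOWER.**  `k = Kf i₀` imaginary quadratic, `E = A 0 ⊨ (k; {τ})`
(`τ(δ) = i√d`), `B_m = A (m+1) ⊨ (K_m; Φ (m+1))` over CM fields `K_m ⊇ i_m(k)` of PRIME `n_m = [K_m : k]`, types read by frames `e m` at position sets `P m` of sizes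
`p_m` (`0 < p_m`, `2 p_m ≤ n_m`); the realised tuples trivial at each slot transitive on every other slot.  Then the Hodge conjecture holds for EVERY product of copies
`⨁_j A(κ j)` GIVEN the single-slot Weil spaces `hW m`.  `HC_CM` is NOT asserted. [cite: Pohlmann1968, Thm 1] [cite: MoonenZarhin1995Duke, Thm. 2.4]
[cite: Milne2020HodgeClassesAV, 1.2 (a) and Thm. 1] [cite: DixonMortimer1996, §1.6 and Thm. 1.6A] -/
theorem hodgeConjectureFor_biproduct_comp_of_stabiliserTransitive_frames (P : ∀ m : Fin r, Finset (Fin (n m))) (p : Fin r → ℕ)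
    (hcard : ∀ m, (P m).card = p m) (hpr : ∀ m, (n m).Prime) (hp0 : ∀ m, 0 < p m) (hpn : ∀ m, 2 * p m ≤ n m)
    {N : ℕ} (κ : Fin N → Fin (r + 1)) (h2 : Module.finrank ℚ (Kf i₀) = 2) (im : ∀ m : Fin r, Kf i₀ →+* Kf (is m))
    {δ : 𝓞 (Kf i₀)} {d : ℕ} (hτ : τ (δ : Kf i₀) = Complex.I * (Real.sqrt d : ℂ))
    (hA : ∀ j, IsCMTypeRealisation (Φ j) (A j) (ι j) (θ j))
    (e : ∀ m : Fin r, (Kf (is m) →+* ℂ) ≃ Fin (n m) × Bool)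
    (he_sign : ∀ (m : Fin r) (s : Kf (is m) →+* ℂ), (e m s).2 = true ↔ s.comp (im m) = τ)
    (he_conj : ∀ (m : Fin r) (s : Kf (is m) →+* ℂ), e m (ComplexEmbedding.conjugate s) = ((e m s).1, !(e m s).2))
    (hΨ : ∀ σ : Kf i₀ →+* ℂ, σ ∈ (Φ 0).1 ↔ σ = τ)
    (hΦ : ∀ (m : Fin r) (s : Kf (is m) →+* ℂ), s ∈ (Φ m.succ).1 ↔ (e m s).2 = decide ((e m s).1 ∈ P m))
    (hstab : ∀ (m₀ m : Fin r), m₀ ≠ m → ∀ a a' : Fin (n m), ∃ ν ∈ realisedTuples e τ, ν m₀ = 1 ∧ ν m a = a')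
    (hW : ∀ m : Fin r, weilClassesOf (⨁ fun i => A (partSlots (n m - 2 * p m) m i))
      (biproduct.map fun i => ι (partSlots (n m - 2 * p m) m i) (δfam im δ (partSlots (n m - 2 * p m) m i))) (n m - p m) d ≤
      algebraicClasses (⨁ fun i => A (partSlots (n m - 2 * p m) m i)).X (n m - p m)) :
    HodgeConjectureFor (⨁ fun j => A (κ j)).dim (⨁ fun j => A (κ j)).X :=
  hodgeConjectureFor_biproduct_comp_of_defectLawG (is := is) P (fun m => n m - 2 * p m) (fun m => n m - p m)
    (fun m => by have := hpn m; omega) (fun m => by have := hp0 m; have := hpn m; omega) κ h2 im hτ hA e he_sign he_conj hΨ hΦ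
    (fun v T hT => exists_hasDefectsG_realisedTuples_of_stabiliserTransitive (e := e) he_sign hpr hstab
      (fun m => Finset.card_pos.1 (by rw [hcard m]; exact hp0 m)) (fun m => by have := hpn m; have := hp0 m; rw [hcard m]; omega)
      (fun m => n m - 2 * p m) (cast_sub_two_mul_eq hcard hpn) v T hT) hW

/-- **INTRINSIC FORM (no frames)**: `[K_m : ℚ] = 2 n_m` with `n_m` PRIME, the `k`-signatures `p_m`, and the stabiliser-transitivity `hST` in automorphism form: for `m₀ ≠ m`
and `τ`-embeddings `s, s'` of `K_m`, an automorphism of `ℂ` over `τ(k)` fixing every `τ`-embedding of `K_{m₀}` carries `s` to `s'`.  `HC_CM` is NOT asserted.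
[cite: Pohlmann1968, Thm 1] [cite: MoonenZarhin1995Duke, Thm. 2.4] [cite: Shimura1998, §18.2 Lemma (i)] -/
theorem hodgeConjectureFor_biproduct_comp_of_stabiliserTransitive (p : Fin r → ℕ) (hpr : ∀ m, (n m).Prime) (hp0 : ∀ m, 0 < p m)
    (hpn : ∀ m, 2 * p m ≤ n m) {N : ℕ} (κ : Fin N → Fin (r + 1)) (h2 : Module.finrank ℚ (Kf i₀) = 2)
    (hdeg : ∀ m : Fin r, Module.finrank ℚ (Kf (is m)) = 2 * n m) (im : ∀ m : Fin r, Kf i₀ →+* Kf (is m))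
    (hST : ∀ (m₀ m : Fin r), m₀ ≠ m → ∀ s s' : Kf (is m) →+* ℂ, s.comp (im m) = τ → s'.comp (im m) = τ →
      ∃ ρ : ℂ ≃+* ℂ, (ρ : ℂ →+* ℂ).comp τ = τ ∧ (∀ u : Kf (is m₀) →+* ℂ, u.comp (im m₀) = τ → (ρ : ℂ →+* ℂ).comp u = u) ∧ (ρ : ℂ →+* ℂ).comp s = s')
    {δ : 𝓞 (Kf i₀)} {d : ℕ} (hτ : τ (δ : Kf i₀) = Complex.I * (Real.sqrt d : ℂ))
    (hA : ∀ j, IsCMTypeRealisation (Φ j) (A j) (ι j) (θ j)) (hΨ : ∀ σ : Kf i₀ →+* ℂ, σ ∈ (Φ 0).1 ↔ σ = τ)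
    (hp : ∀ m : Fin r, (Finset.univ.filter fun s : Kf (is m) →+* ℂ => s.comp (im m) = τ ∧ s ∈ (Φ m.succ).1).card = p m)
    (hW : ∀ m : Fin r, weilClassesOf (⨁ fun i => A (partSlots (n m - 2 * p m) m i))
      (biproduct.map fun i => ι (partSlots (n m - 2 * p m) m i) (δfam im δ (partSlots (n m - 2 * p m) m i))) (n m - p m) d ≤
      algebraicClasses (⨁ fun i => A (partSlots (n m - 2 * p m) m i)).X (n m - p m)) :
    HodgeConjectureFor (⨁ fun j => A (κ j)).dim (⨁ fun j => A (κ j)).X := by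
  have hττ : ComplexEmbedding.conjugate τ ≠ τ := QuarticCM.conjugate_ne τ
  have hk : ∀ σ : Kf i₀ →+* ℂ, σ = τ ∨ σ = ComplexEmbedding.conjugate τ := fun σ => QuarticCM.eq_or_eq_conjugate_of_quadratic h2 τ σ
  have hfr : ∀ m : Fin r, ∃ e : (Kf (is m) →+* ℂ) ≃ Fin (n m) × Bool, (∀ s, (e s).2 = true ↔ s.comp (im m) = τ) ∧
      ∀ s, e (ComplexEmbedding.conjugate s) = ((e s).1, !(e s).2) := fun m => exists_signFrame (hdeg m) h2 (im m) hττ hk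
  choose e he_sign he_conj using hfr
  exact hodgeConjectureFor_biproduct_comp_of_stabiliserTransitive_frames
    (fun m => Finset.univ.filter fun a : Fin (n m) => (e m).symm (a, true) ∈ (Φ m.succ).1) p
    (fun m => (card_posSet (he_sign m) (Φ m.succ)).trans (hp m)) hpr hp0 hpn κ h2 im hτ hA e he_sign he_conj hΨ
    (fun m s => mem_iff_snd_eq_decide_mem_posSet (he_conj m) (Φ m.succ) s) (stabTransitive_realisedTuples_of_aut he_sign hST) hW

/-- **… and for every abelian variety DOMINATED by such a product.** `HC_CM` is NOT asserted. [cite: MumfordAV1970, §19] [cite: Pohlmann1968, Thm 1] -/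
theorem hodgeConjectureFor_of_avDominatedBy_comp_of_stabiliserTransitive (p : Fin r → ℕ) (hpr : ∀ m, (n m).Prime) (hp0 : ∀ m, 0 < p m)
    (hpn : ∀ m, 2 * p m ≤ n m) {N : ℕ} (κ : Fin N → Fin (r + 1)) (h2 : Module.finrank ℚ (Kf i₀) = 2)
    (hdeg : ∀ m : Fin r, Module.finrank ℚ (Kf (is m)) = 2 * n m) (im : ∀ m : Fin r, Kf i₀ →+* Kf (is m))
    (hST : ∀ (m₀ m : Fin r), m₀ ≠ m → ∀ s s' : Kf (is m) →+* ℂ, s.comp (im m) = τ → s'.comp (im m) = τ →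
      ∃ ρ : ℂ ≃+* ℂ, (ρ : ℂ →+* ℂ).comp τ = τ ∧ (∀ u : Kf (is m₀) →+* ℂ, u.comp (im m₀) = τ → (ρ : ℂ →+* ℂ).comp u = u) ∧ (ρ : ℂ →+* ℂ).comp s = s')
    {δ : 𝓞 (Kf i₀)} {d : ℕ} (hτ : τ (δ : Kf i₀) = Complex.I * (Real.sqrt d : ℂ))
    (hA : ∀ j, IsCMTypeRealisation (Φ j) (A j) (ι j) (θ j)) (hΨ : ∀ σ : Kf i₀ →+* ℂ, σ ∈ (Φ 0).1 ↔ σ = τ)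
    (hp : ∀ m : Fin r, (Finset.univ.filter fun s : Kf (is m) →+* ℂ => s.comp (im m) = τ ∧ s ∈ (Φ m.succ).1).card = p m)
    (hW : ∀ m : Fin r, weilClassesOf (⨁ fun i => A (partSlots (n m - 2 * p m) m i))
      (biproduct.map fun i => ι (partSlots (n m - 2 * p m) m i) (δfam im δ (partSlots (n m - 2 * p m) m i))) (n m - p m) d ≤
      algebraicClasses (⨁ fun i => A (partSlots (n m - 2 * p m) m i)).X (n m - p m))
    {X : AbelianVariety ℂ} (hX : Domination.AVDominatedBy X (⨁ fun j => A (κ j))) : HodgeConjectureFor X.dim X.X :=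
  Domination.hodgeConjectureFor_of_avDominatedBy
    (hodgeConjectureFor_biproduct_comp_of_stabiliserTransitive p hpr hp0 hpn κ h2 hdeg im hST hτ hA hΨ hp hW) hX

/-! ## §3 Sextic `(1,2)` and decic `(2,3)` slots: Markman's theorems alone -/

/-- **HEADLINE — ANY NUMBER OF SEXTIC `(1,2)` AND DECIC `(2,3)` CM FIELDS SHARING `k` WITH STABILISER-TRANSITIVE AUTOMORPHISMS, GIVEN ONLY MARKMAN'S TWO THEOREMS —
NO TOWER, NO ORDERING.**  `k = Kf i₀` imaginary quadratic, `E = A 0 ⊨ (k; {τ})`, `B_m = A (m+1) ⊨ (K_m; Φ (m+1))`, `[K_m : ℚ] = 2 n_m` with `(n_m, p_m) ∈ {(3,1), (5,2)}`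
(`p_m` members of `Φ (m+1)` over `τ`); for `m₀ ≠ m` and `τ`-embeddings `s, s'` of `K_m` an automorphism of `ℂ` over `τ(k)` fixes all `τ`-embeddings of `K_{m₀}` and carries
`s` to `s'`.  Then the Hodge conjecture holds for EVERY product of copies `⨁_j A(κ j)`.  `HC_CM` is NOT asserted. [cite: Markman2025SurveySecant, Thm. 1.2]
[cite: Markman2025SecantWeil, Thm 1.5.1] [cite: Pohlmann1968, Thm 1] [cite: MoonenZarhin1995Duke, Thm. 2.4] -/
theorem hodgeConjectureFor_biproduct_comp_of_sexticsDecics_of_stabiliserTransitive (hW4 : Markman2025_weilClasses_algebraic_abelianFourfold)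
    (hM6 : Markman2025_weilClasses_algebraic_hyperbolicSixfold) (n p : Fin r → ℕ) (hnp : ∀ m, (n m = 3 ∧ p m = 1) ∨ (n m = 5 ∧ p m = 2))
    {N : ℕ} (κ : Fin N → Fin (r + 1)) (h2 : Module.finrank ℚ (Kf i₀) = 2) (hdeg : ∀ m : Fin r, Module.finrank ℚ (Kf (is m)) = 2 * n m)
    (im : ∀ m : Fin r, Kf i₀ →+* Kf (is m)) (hA : ∀ j, IsCMTypeRealisation (Φ j) (A j) (ι j) (θ j)) (hΨ : ∀ σ : Kf i₀ →+* ℂ, σ ∈ (Φ 0).1 ↔ σ = τ)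
    (hp : ∀ m : Fin r, (Finset.univ.filter fun s : Kf (is m) →+* ℂ => s.comp (im m) = τ ∧ s ∈ (Φ m.succ).1).card = p m)
    (hST : ∀ (m₀ m : Fin r), m₀ ≠ m → ∀ s s' : Kf (is m) →+* ℂ, s.comp (im m) = τ → s'.comp (im m) = τ →
      ∃ ρ : ℂ ≃+* ℂ, (ρ : ℂ →+* ℂ).comp τ = τ ∧ (∀ u : Kf (is m₀) →+* ℂ, u.comp (im m₀) = τ → (ρ : ℂ →+* ℂ).comp u = u) ∧ (ρ : ℂ →+* ℂ).comp s = s') :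
    HodgeConjectureFor (⨁ fun j => A (κ j)).dim (⨁ fun j => A (κ j)).X := by
  obtain ⟨δ₀, d, hd, hδ₀⟩ := CyclicSextic.exists_sq_eq_neg_nat_of_isTotallyComplex (Kf i₀) h2
  obtain ⟨δ, hδ, hτ⟩ := OcticCurveFourfold.exists_delta_of_mem h2 hd hδ₀ τ
  refine hodgeConjectureFor_biproduct_comp_of_stabiliserTransitive (is := is) (n := n) p (fun m => ?_) (fun m => ?_) (fun m => ?_) κ h2 hdeg im hST hτ hA hΨ hp
    fun m => ?_
  · rcases hnp m with ⟨h, -⟩ | ⟨h, -⟩ <;> rw [h] <;> norm_num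
  · rcases hnp m with ⟨-, h⟩ | ⟨-, h⟩ <;> rw [h] <;> norm_num
  · rcases hnp m with ⟨h, h'⟩ | ⟨h, h'⟩ <;> rw [h, h'] <;> norm_num
  · exact weilHyp_of_markman_intrinsic hW4 hM6 m ((hnp m).elim (fun h => Or.inl h) fun h => Or.inr (Or.inr (Or.inr h))) (hdeg m) h2 hd hδ hA hΨ (hp m)

/-- **Dominated form.** [cite: Markman2025SurveySecant, Thm. 1.2] [cite: Markman2025SecantWeil, Thm 1.5.1] [cite: MumfordAV1970, §19] -/
theorem hodgeConjectureFor_of_avDominatedBy_comp_of_sexticsDecics_of_stabiliserTransitive (hW4 : Markman2025_weilClasses_algebraic_abelianFourfold)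
    (hM6 : Markman2025_weilClasses_algebraic_hyperbolicSixfold) (n p : Fin r → ℕ) (hnp : ∀ m, (n m = 3 ∧ p m = 1) ∨ (n m = 5 ∧ p m = 2))
    {N : ℕ} (κ : Fin N → Fin (r + 1)) (h2 : Module.finrank ℚ (Kf i₀) = 2) (hdeg : ∀ m : Fin r, Module.finrank ℚ (Kf (is m)) = 2 * n m)
    (im : ∀ m : Fin r, Kf i₀ →+* Kf (is m)) (hA : ∀ j, IsCMTypeRealisation (Φ j) (A j) (ι j) (θ j)) (hΨ : ∀ σ : Kf i₀ →+* ℂ, σ ∈ (Φ 0).1 ↔ σ = τ)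
    (hp : ∀ m : Fin r, (Finset.univ.filter fun s : Kf (is m) →+* ℂ => s.comp (im m) = τ ∧ s ∈ (Φ m.succ).1).card = p m)
    (hST : ∀ (m₀ m : Fin r), m₀ ≠ m → ∀ s s' : Kf (is m) →+* ℂ, s.comp (im m) = τ → s'.comp (im m) = τ →
      ∃ ρ : ℂ ≃+* ℂ, (ρ : ℂ →+* ℂ).comp τ = τ ∧ (∀ u : Kf (is m₀) →+* ℂ, u.comp (im m₀) = τ → (ρ : ℂ →+* ℂ).comp u = u) ∧ (ρ : ℂ →+* ℂ).comp s = s')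
    {X : AbelianVariety ℂ} (hX : Domination.AVDominatedBy X (⨁ fun j => A (κ j))) : HodgeConjectureFor X.dim X.X :=
  Domination.hodgeConjectureFor_of_avDominatedBy
    (hodgeConjectureFor_biproduct_comp_of_sexticsDecics_of_stabiliserTransitive hW4 hM6 n p hnp κ h2 hdeg im hA hΨ hp hST) hX

/-! ## §4 Sextic fields only: the PAIRWISE Galois-closure condition -/

/-- **HEADLINE — ANY NUMBER OF SEXTIC CM FIELDS THROUGH `k`, EACH HAVING NO `τ`-EMBEDDING INTO THE GALOIS CLOSURE OF ANOTHER, GIVEN ONLY MARKMAN'S FOURFOLD THEOREM.**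
`k = Kf i₀` imaginary quadratic, `E = A 0 ⊨ (k; {τ})`, `T_m = A (m+1) ⊨ (K_m; Φ (m+1))` over SEXTIC CM fields `K_m ⊇ i_m(k)` with ONE member of `Φ (m+1)` over `τ`
(`(1,2)`-threefolds), such that for `m₀ ≠ m` EVERY `τ`-embedding of `K_m` takes a value outside the Galois closure of `K_{m₀}` in `ℂ` (a PAIRWISE condition — no tower, no
order; e.g. the pure cubic triple `k(∛2), k(∛3), k(∛6)`, `k = ℚ(√−3)`).  Then the Hodge conjecture holds for EVERY product of copies `E^a × ∏_m T_m^{b_m}`.  `HC_CM` is NOT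
asserted. [cite: Markman2025SurveySecant, Thm. 1.2] [cite: Pohlmann1968, Thm 1] [cite: MoonenZarhin1995Duke, Thm. 2.4] [cite: Lang2002, VI §1 Thm. 1.1 and Cor. 1.6] -/
theorem hodgeConjectureFor_biproduct_comp_of_sextics_of_outside_closures (hW4 : Markman2025_weilClasses_algebraic_abelianFourfold)
    {N : ℕ} (κ : Fin N → Fin (r + 1)) (h2 : Module.finrank ℚ (Kf i₀) = 2) (h6 : ∀ m : Fin r, Module.finrank ℚ (Kf (is m)) = 6)
    (im : ∀ m : Fin r, Kf i₀ →+* Kf (is m)) (hA : ∀ j, IsCMTypeRealisation (Φ j) (A j) (ι j) (θ j)) (hΨ : ∀ σ : Kf i₀ →+* ℂ, σ ∈ (Φ 0).1 ↔ σ = τ)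
    (h1 : ∀ m : Fin r, (Finset.univ.filter fun s : Kf (is m) →+* ℂ => s.comp (im m) = τ ∧ s ∈ (Φ m.succ).1).card = 1)
    (hout : ∀ (m₀ m : Fin r), m₀ ≠ m → ∀ s : Kf (is m) →+* ℂ, s.comp (im m) = τ → ∃ x, s x ∉ normalClosure ℚ (Kf (is m₀)) ℂ) :
    HodgeConjectureFor (⨁ fun j => A (κ j)).dim (⨁ fun j => A (κ j)).X := by
  obtain ⟨δ₀, d, hd, hδ₀⟩ := CyclicSextic.exists_sq_eq_neg_nat_of_isTotallyComplex (Kf i₀) h2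
  obtain ⟨δ, hδ, hτ⟩ := OcticCurveFourfold.exists_delta_of_mem h2 hd hδ₀ τ
  have hττ : ComplexEmbedding.conjugate τ ≠ τ := QuarticCM.conjugate_ne τ
  have hk : ∀ σ : Kf i₀ →+* ℂ, σ = τ ∨ σ = ComplexEmbedding.conjugate τ := fun σ => QuarticCM.eq_or_eq_conjugate_of_quadratic h2 τ σ
  have hfr : ∀ m : Fin r, ∃ e : (Kf (is m) →+* ℂ) ≃ Fin 3 × Bool, (∀ s, (e s).2 = true ↔ s.comp (im m) = τ) ∧
      ∀ s, e (ComplexEmbedding.conjugate s) = ((e s).1, !(e s).2) := fun m => exists_signFrame (n := 3) (by rw [h6 m]) h2 (im m) hττ hk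
  choose e he_sign he_conj using hfr
  refine hodgeConjectureFor_biproduct_comp_of_stabiliserTransitive_frames (is := is) (n := fun _ => 3)
    (fun m => Finset.univ.filter fun a : Fin 3 => (e m).symm (a, true) ∈ (Φ m.succ).1) (fun _ => 1)
    (fun m => (card_posSet (he_sign m) (Φ m.succ)).trans (h1 m)) (fun _ => by norm_num) (fun _ => Nat.one_pos) (fun _ => by norm_num) κ h2 im hτ hA e he_sign
    he_conj hΨ (fun m s => mem_iff_snd_eq_decide_mem_posSet (he_conj m) (Φ m.succ) s) (fun m₀ m hm a a' => ?_) fun m => ?_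
  · exact stabTransitive_realisedTuples_of_outside (e := e) he_sign (fun _ => Nat.succ_pos 2) m₀ m rfl (hout m₀ m hm) a a'
  · exact weilHyp_of_markman_fourfold_intrinsic hW4 m (h6 m) h2 hd hδ hA hΨ (h1 m)

/-- **Dominated form.** [cite: Markman2025SurveySecant, Thm. 1.2] [cite: MumfordAV1970, §19] -/
theorem hodgeConjectureFor_of_avDominatedBy_comp_of_sextics_of_outside_closures (hW4 : Markman2025_weilClasses_algebraic_abelianFourfold)
    {N : ℕ} (κ : Fin N → Fin (r + 1)) (h2 : Module.finrank ℚ (Kf i₀) = 2) (h6 : ∀ m : Fin r, Module.finrank ℚ (Kf (is m)) = 6)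
    (im : ∀ m : Fin r, Kf i₀ →+* Kf (is m)) (hA : ∀ j, IsCMTypeRealisation (Φ j) (A j) (ι j) (θ j)) (hΨ : ∀ σ : Kf i₀ →+* ℂ, σ ∈ (Φ 0).1 ↔ σ = τ)
    (h1 : ∀ m : Fin r, (Finset.univ.filter fun s : Kf (is m) →+* ℂ => s.comp (im m) = τ ∧ s ∈ (Φ m.succ).1).card = 1)
    (hout : ∀ (m₀ m : Fin r), m₀ ≠ m → ∀ s : Kf (is m) →+* ℂ, s.comp (im m) = τ → ∃ x, s x ∉ normalClosure ℚ (Kf (is m₀)) ℂ)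
    {X : AbelianVariety ℂ} (hX : Domination.AVDominatedBy X (⨁ fun j => A (κ j))) : HodgeConjectureFor X.dim X.X :=
  Domination.hodgeConjectureFor_of_avDominatedBy (hodgeConjectureFor_biproduct_comp_of_sextics_of_outside_closures hW4 κ h2 h6 im hA hΨ h1 hout) hX

end Headline

end Summit.HodgeConjecture.CorCM.MultiFieldWeil

end
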